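import Summits.RiemannHypothesis.RiemannHypothesis.Theorems.PfPersistencePerronFakeNodelessFoldGain
import Summits.RiemannHypothesis.RiemannHypothesis.Theorems.GroundBartaPolarPerronFrobeniusSignImprovingBarrier
import HarnessLib

/-!
# PF persistence — PERRON-FAKE (S6), part 5d: the FOLD BARRIER for EVERY real table
# (the full windowed form of an arbitrary real table is NOT sign-improving on the finite-energy
# class at any window `a ≥ 3/20`; the abstract separated-lobe witness)

`pub-rhpf` cell, unit `pub-rhpf-prover-perron` (S6; CASE-DAG §6 row PERRON-FAKE; leaves G1.01 / G1.02,
FAKE column; table-side reading of leaf G1.19).  **Mechanism / rigidity campaign; no RH claims.**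
RH-free, definition-free: Mathlib + proved tree files only.  A NEGATIVE-SIDE output of the S6 line.

Part 5c proves the fold-gain laws: below `log 2/2` the table drops out of `Q^w_a(u) − Q^w_a(|u|)` and
the full windowed form `tableClosedForm a w` of EVERY real table is sign-improving on `coreAdm a` for
`0 < a ≤ 1/8` (even members: `0 < a ≤ 11/40`).  This file and part 5e prove that the same
table-blindness holds on the OTHER side of the kernel thresholds: the table ALSO drops out of the
obstruction.

* `fold_lt_of_separated` — the abstract witness.  If `u⁺ = p`, `u⁻ = q` with the lobes separated by
  at least `s > 0` (`p x ≠ 0`, `q y ≠ 0 ⇒ s ≤ |x − y|`), no prime length of the window joining them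
  (`q y ≠ 0 ⇒ p(y ± log n) = 0` for `n ∈ weilPrimeIndex a`), both lobes of positive mass, and
  `ρ(s) < 2cosh(s/2)`, then `Q^w_a(u) < Q^w_a(|u|)` for EVERY real table `w`: by the lobe-balance law
  (part 1) `Q(|u|) − Q(u) = −4∫u⁻·S_u`, and on the negative lobe
  `S_u ≤ (ρ(s) − 2cosh(s/2))·∫u⁺ < 0` (the archimedean pairing at distance `≥ s` is `≤ ρ(s)`, the
  atomic part vanishes by the avoidance hypothesis, the polar subtraction is `≥ 2cosh(s/2)`).
* `weilArchDensity_lt_two_of` — numerics: `ρ(29/100) < 2` (quadratic Taylor bounds), whence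
  `ρ(29/100) < 2cosh(29/200)`.
* `exists_fold_lt_of_ge` — for every real table `w` and every window `a ≥ 3/20` an explicit smooth
  `u ∈ coreAdm a` (bumps of radius `1/400` at `±59/400`, separation `29/100`) with
  `Q^w_a(u) < Q^w_a(|u|)`; `not_forall_fold_le_of_ge` — the form is NOT SIGN-IMPROVING on the
  finite-energy class.  (Part 5e: the even witness at every `a ≥ 3/10`.)

READING (honest scope).  With part 5c this brackets, for every real table at once, the windows on
which the Beurling–Deny / first-Kato route `u ↦ |u|` can certify nodelessness of ground states of the
full form: available on `(0, 1/8]`, UNAVAILABLE from `3/20` on, whatever the table (true kernel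
threshold `0.1406…`, DERIVED, in the gap).  This is a statement about the METHOD, not about ground
states: a form that is not sign-improving may well have one-signed ground states, and nothing here
asserts or denies `AllEvenGroundStatesOneSigned a w` at any served window, for `ζ` or for any
control.  It generalises the tree's `ζ`-side barrier `sw_not_signImproving_of_ge` (`a ≥ 3/10`) to
arbitrary real tables with the better constant `3/20` (the witness avoids every prime length, so the
table never acts).  Nothing here is a statement about positivity of any form.
-/

open MeasureTheory Set Filter Literature.NumberTheory.LFunctions
open Summit.RiemannHypothesis.RiemannHypothesis.Theorems.PolarPerronFrobenius

namespace Summit.RiemannHypothesis.RiemannHypothesis.Theorems.PfPersistence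

variable {a : ℝ} {u : ℝ → ℝ}

/-! ### The abstract witness: separated lobes joined by no prime length -/

/-- **Separated lobes raise the fold (PROVED; every real table).**  Let `u` be a real member of the
finite-energy class of the window with `u⁺ = p`, `u⁻ = q`, the two lobes at mutual distance `≥ s > 0`,
no prime length of the window joining them, both of positive mass, and `ρ(s) < 2cosh(s/2)`.  Then
`Q^w_a(u) < Q^w_a(|u|)`. [folklore] -/
theorem fold_lt_of_separated (w : ℕ → ℝ) {p q : ℝ → ℝ} {s : ℝ} (hum : Measurable u)
    (hU : coreAdm a (fun x ↦ ((u x : ℝ) : ℂ)))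
    (hpos : ∀ x, max (u x) 0 = p x) (hneg : ∀ x, max (-u x) 0 = q x) (hs : 0 < s)
    (hsep : ∀ x y, p x ≠ 0 → q y ≠ 0 → s ≤ |x - y|)
    (hprime : ∀ n ∈ weilPrimeIndex a, ∀ y, q y ≠ 0 →
      p (y + Real.log n) = 0 ∧ p (y - Real.log n) = 0)
    (hker : weilArchDensity s < 2 * Real.cosh (s / 2))
    (hIp : 0 < ∫ x, p x) (hIq : 0 < ∫ x, q x) :
    tableClosedForm a w (fun x ↦ ((u x : ℝ) : ℂ)) <
      tableClosedForm a w (fun x ↦ ((|u x| : ℝ) : ℂ)) := by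
  have hU2 : MemLp (fun x ↦ ((u x : ℝ) : ℂ)) 2 volume := hU.1
  have hu2 : MemLp u 2 volume :=
    MemLp.of_le hU2 hum.aestronglyMeasurable (Eventually.of_forall fun x ↦ by simp)
  have hus' : ∀ x : ℝ, x ∉ Icc (-a) a → u x = 0 := fun x hx ↦ by
    have h := hU.2.1 x hx
    simpa using h
  have hus : ∀ᵐ x : ℝ, x ∉ Icc (-a) a → u x = 0 := Eventually.of_forall hus'
  have hp1 : Integrable fun x ↦ max (u x) 0 :=
    swg_integrable_of_memLp (swg_memLp_posPart hu2) (swg_posPart_ae_zero hus)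
  have hn1 : Integrable fun x ↦ max (-u x) 0 :=
    swg_integrable_of_memLp (swg_memLp_negPart hu2) (swg_negPart_ae_zero hus)
  have hpm : Measurable fun x ↦ max (u x) 0 := hum.max measurable_const
  have hp0 : ∀ x, 0 ≤ max (u x) 0 := fun x ↦ le_max_right _ _
  have hcont : ∀ y, Continuous fun x : ℝ ↦ Real.cosh ((x - y) / 2) := fun y ↦
    Real.continuous_cosh.comp ((continuous_id.sub continuous_const).div_const 2)
  -- transfer the hypotheses to `u⁺`, `u⁻`
  have hP : (fun x ↦ max (u x) 0) = p := funext hpos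
  have hQ : (fun x ↦ max (-u x) 0) = q := funext hneg
  have hIp' : 0 < ∫ x, max (u x) 0 := by rw [hP]; exact hIp
  have hIq' : 0 < ∫ x, max (-u x) 0 := by rw [hQ]; exact hIq
  have hsep' : ∀ x y, max (u x) 0 ≠ 0 → max (-u y) 0 ≠ 0 → s ≤ |x - y| := fun x y hx hy ↦
    hsep x y (by rwa [← hpos]) (by rwa [← hneg])
  have hprime' : ∀ n ∈ weilPrimeIndex a, ∀ y, max (-u y) 0 ≠ 0 →
      max (u (y + Real.log n)) 0 = 0 ∧ max (u (y - Real.log n)) 0 = 0 := by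
    intro n hn y hy
    rw [hpos, hpos]
    exact hprime n hn y (by rwa [← hneg])
  -- (1) the lobe-balance law of part 1
  obtain ⟨hid, hIS⟩ := tableClosedForm_abs_sub_eq_source w hum hU
    (fun y ↦ (∫ t in Ioi (0 : ℝ), weilArchDensity t * (max (u (y + t)) 0 + max (u (y - t)) 0)) +
      (∑ n ∈ weilPrimeIndex a, w n * (max (u (y + Real.log n)) 0 + max (u (y - Real.log n)) 0)) -
      2 * ∫ x, max (u x) 0 * Real.cosh ((x - y) / 2)) (fun y ↦ rfl)
  -- (2) on the negative lobe the source is `≤ (ρ(s) − 2cosh(s/2))·∫u⁺`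
  have hpt : ∀ y, max (-u y) 0 *
      ((∫ t in Ioi (0 : ℝ), weilArchDensity t * (max (u (y + t)) 0 + max (u (y - t)) 0)) +
        (∑ n ∈ weilPrimeIndex a, w n * (max (u (y + Real.log n)) 0 + max (u (y - Real.log n)) 0)) -
        2 * ∫ x, max (u x) 0 * Real.cosh ((x - y) / 2)) ≤
      max (-u y) 0 * ((weilArchDensity s - 2 * Real.cosh (s / 2)) * ∫ x, max (u x) 0) := by
    intro y
    by_cases hy : max (-u y) 0 = 0
    · rw [hy, zero_mul, zero_mul]
    refine mul_le_mul_of_nonneg_left ?_ (le_max_right _ _)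
    -- (2a) the atomic part vanishes: no prime length joins the lobes
    have h1 : ∑ n ∈ weilPrimeIndex a,
        w n * (max (u (y + Real.log n)) 0 + max (u (y - Real.log n)) 0) = 0 := by
      refine Finset.sum_eq_zero fun n hn ↦ ?_
      obtain ⟨e1, e2⟩ := hprime' n hn y hy
      rw [e1, e2, add_zero, mul_zero]
    -- (2b) the archimedean pairing at distance `≥ s` is `≤ ρ(s)·∫u⁺`
    have h2 : ∫ t in Ioi (0 : ℝ), weilArchDensity t * (max (u (y + t)) 0 + max (u (y - t)) 0) ≤
        weilArchDensity s * ∫ x, max (u x) 0 := by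
      have hint : Integrable (fun t ↦ max (u (y + t)) 0 + max (u (y - t)) 0)
          (volume.restrict (Ioi 0)) :=
        ((hp1.comp_add_left y).add (hp1.comp_sub_left y)).restrict
      have hle : ∀ t ∈ Ioi (0 : ℝ),
          weilArchDensity t * (max (u (y + t)) 0 + max (u (y - t)) 0) ≤
            weilArchDensity s * (max (u (y + t)) 0 + max (u (y - t)) 0) := by
        intro t ht
        have ht0 : 0 < t := ht
        by_cases hz : max (u (y + t)) 0 + max (u (y - t)) 0 = 0
        · rw [hz, mul_zero, mul_zero]
        have hst : s ≤ t := by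
          by_cases h1 : max (u (y + t)) 0 = 0
          · have h2 : max (u (y - t)) 0 ≠ 0 := fun h ↦ hz (by rw [h1, h, add_zero])
            have := hsep' (y - t) y h2 hy
            rwa [show y - t - y = -t by ring, abs_neg, abs_of_pos ht0] at this
          · have := hsep' (y + t) y h1 hy
            rwa [show y + t - y = t by ring, abs_of_pos ht0] at this
        exact mul_le_mul_of_nonneg_right
          (weilArchDensity_antitoneOn (mem_Ioi.2 hs) (mem_Ioi.2 ht0) hst)
          (add_nonneg (hp0 _) (hp0 _))
      have hmeas : AEStronglyMeasurable
          (fun t ↦ weilArchDensity t * (max (u (y + t)) 0 + max (u (y - t)) 0))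
          (volume.restrict (Ioi 0)) :=
        (measurable_weilArchDensity.mul ((hpm.comp (measurable_const.add measurable_id)).add
          (hpm.comp (measurable_const.sub measurable_id)))).aestronglyMeasurable
      have hintL : IntegrableOn
          (fun t ↦ weilArchDensity t * (max (u (y + t)) 0 + max (u (y - t)) 0)) (Ioi 0) := by
        refine Integrable.mono' (hint.const_mul (weilArchDensity s)) hmeas ?_
        filter_upwards [ae_restrict_mem measurableSet_Ioi] with t ht
        rw [Real.norm_of_nonneg
          (mul_nonneg (weilArchDensity_pos ht).le (add_nonneg (hp0 _) (hp0 _)))]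
        exact hle t ht
      calc ∫ t in Ioi (0 : ℝ), weilArchDensity t * (max (u (y + t)) 0 + max (u (y - t)) 0)
          ≤ ∫ t in Ioi (0 : ℝ), weilArchDensity s * (max (u (y + t)) 0 + max (u (y - t)) 0) :=
            setIntegral_mono_on hintL (hint.const_mul _) measurableSet_Ioi hle
        _ = weilArchDensity s * ∫ x, max (u x) 0 := by
            rw [integral_const_mul, integral_Ioi_add_sub_eq hp1 y]
    -- (2c) the polar subtraction at distance `≥ s` is `≥ 2cosh(s/2)·∫u⁺`
    have h3 : Real.cosh (s / 2) * ∫ x, max (u x) 0 ≤ ∫ x, max (u x) 0 * Real.cosh ((x - y) / 2) := by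
      rw [show Real.cosh (s / 2) * ∫ x, max (u x) 0 = ∫ x, max (u x) 0 * Real.cosh (s / 2) by
        rw [integral_mul_const]; ring]
      refine integral_mono (hp1.mul_const _)
        (swg_integrable_mul_continuous hp1 (swg_posPart_ae_zero hus) (hcont y)) fun x ↦ ?_
      by_cases hx : max (u x) 0 = 0
      · simp only [hx, zero_mul, le_refl]
      · refine mul_le_mul_of_nonneg_left ?_ (hp0 x)
        rw [Real.cosh_le_cosh, abs_of_nonneg (by linarith : 0 ≤ s / 2), abs_div, abs_two]
        have := hsep' x y hx hy
        linarith
    rw [h1, add_zero]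
    linarith
  -- (3) integrate against `u⁻` and conclude
  have hI : ∫ y, max (-u y) 0 *
      ((∫ t in Ioi (0 : ℝ), weilArchDensity t * (max (u (y + t)) 0 + max (u (y - t)) 0)) +
        (∑ n ∈ weilPrimeIndex a, w n * (max (u (y + Real.log n)) 0 + max (u (y - Real.log n)) 0)) -
        2 * ∫ x, max (u x) 0 * Real.cosh ((x - y) / 2)) ≤
      (∫ y, max (-u y) 0) * ((weilArchDensity s - 2 * Real.cosh (s / 2)) * ∫ x, max (u x) 0) := by
    have h := integral_mono hIS (hn1.mul_const _) hpt
    rwa [integral_mul_const] at h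
  have hlt : (∫ y, max (-u y) 0) * ((weilArchDensity s - 2 * Real.cosh (s / 2)) * ∫ x, max (u x) 0)
      < 0 := by
    have h' : (weilArchDensity s - 2 * Real.cosh (s / 2)) * ∫ x, max (u x) 0 < 0 :=
      mul_neg_of_neg_of_pos (by linarith) hIp'
    exact mul_neg_of_pos_of_neg hIq' h'
  linarith [hid, hI, hlt]

/-! ### Numerics: `ρ(29/100) < 2 ≤ 2cosh(29/200)` -/

/-- `ρ(29/100) < 2` (`e^{29/200} ≥ 1.1555`, `e^{−87/200} ≤ 0.6538`, quadratic Taylor bounds).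
[folklore] -/
theorem weilArchDensity_lt_two_of : weilArchDensity (29 / 100) < 2 := by
  rw [weilArchDensity_eq_inv (by norm_num : (0 : ℝ) < 29 / 100)]
  have e1 : Real.exp ((29 / 100 : ℝ) / 2) = Real.exp (29 / 200) := by norm_num
  have e2 : Real.exp (-(3 * (29 / 100 : ℝ) / 2)) = Real.exp (-(87 / 200)) := by norm_num
  rw [e1, e2]
  have h1 : (1 : ℝ) + 29 / 200 + (29 / 200) ^ 2 / 2 ≤ Real.exp (29 / 200) :=
    Real.quadratic_le_exp_of_nonneg (by norm_num)
  have h2 : (1 : ℝ) + 87 / 200 + (87 / 200) ^ 2 / 2 ≤ Real.exp (87 / 200) :=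
    Real.quadratic_le_exp_of_nonneg (by norm_num)
  have h2' : Real.exp (-(87 / 200)) ≤ ((1 : ℝ) + 87 / 200 + (87 / 200) ^ 2 / 2)⁻¹ := by
    rw [Real.exp_neg]
    exact inv_anti₀ (by norm_num) h2
  have h3 : ((1 : ℝ) + 87 / 200 + (87 / 200) ^ 2 / 2)⁻¹ ≤ 6538 / 10000 := by norm_num
  have hpos : 0 < Real.exp (29 / 200) - Real.exp (-(87 / 200)) :=
    sub_pos.2 (Real.exp_lt_exp.2 (by norm_num))
  rw [inv_lt_comm₀ hpos (by norm_num : (0 : ℝ) < 2), show (2 : ℝ)⁻¹ = 1 / 2 by norm_num]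
  norm_num at h1
  linarith

/-- `ρ(29/100) < 2cosh(29/200)`. [folklore] -/
theorem weilArchDensity_lt_two_mul_cosh_of :
    weilArchDensity (29 / 100) < 2 * Real.cosh (29 / 100 / 2) := by
  have h1 := weilArchDensity_lt_two_of
  have h2 := Real.one_le_cosh (29 / 100 / 2 : ℝ)
  linarith

/-! ### Bump facts -/

/-- A bump of outer radius `r` centred at `c` vanishes at distance `≥ r` from `c`. [folklore] -/
theorem bump_eq_zero_of_le {c : ℝ} (f : ContDiffBump c) {x : ℝ} (hx : f.rOut ≤ |x - c|) : f x = 0 :=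
  f.zero_of_le_dist (by rwa [Real.dist_eq])

/-- A symmetrised pair of bumps is smooth. [folklore] -/
theorem contDiff_bump_add_bump_neg {c : ℝ} (f : ContDiffBump c) :
    ContDiff ℝ (⊤ : ℕ∞) fun t : ℝ ↦ f t + f (-t) :=
  f.contDiff.add (f.contDiff.comp contDiff_neg)

/-- A function vanishing off `[-b, b]` has `tsupport ⊆ [-b, b]` and compact support. [folklore] -/
theorem tsupport_subset_of_eq_zero {g : ℝ → ℝ} {b : ℝ} (hg : ∀ x, b < |x| → g x = 0) :
    tsupport g ⊆ Icc (-b) b ∧ HasCompactSupport g := by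
  have hsub : Function.support g ⊆ Icc (-b) b := by
    intro x hx
    rw [Function.mem_support] at hx
    by_contra h
    refine hx (hg x ?_)
    rw [mem_Icc, not_and_or, not_le, not_le] at h
    rcases h with h | h
    · linarith [neg_abs_le x]
    · linarith [le_abs_self x]
  have ht : tsupport g ⊆ Icc (-b) b := closure_minimal hsub isClosed_Icc
  exact ⟨ht, HasCompactSupport.of_support_subset_isCompact isCompact_Icc hsub⟩

/-! ### The parity-free barrier at every window `a ≥ 3/20` -/

/-- **The full windowed form of EVERY real table is NOT sign-improving at any window `a ≥ 3/20`
(PROVED).**  For every real table `w` and every `a ≥ 3/20` there is a smooth real `u` in the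
finite-energy class `coreAdm a` with `Q^w_a(u) < Q^w_a(|u|)` (bumps of radius `1/400` at `±59/400`:
separation `29/100 > 0.1406…·2`, no prime length joins them). [folklore] -/
theorem exists_fold_lt_of_ge (w : ℕ → ℝ) (ha : 3 / 20 ≤ a) :
    ∃ u : ℝ → ℝ, Measurable u ∧ coreAdm a (fun x ↦ ((u x : ℝ) : ℂ)) ∧
      tableClosedForm a w (fun x ↦ ((u x : ℝ) : ℂ)) <
        tableClosedForm a w (fun x ↦ ((|u x| : ℝ) : ℂ)) := by
  let pb : ContDiffBump (59 / 400 : ℝ) := ⟨1 / 800, 1 / 400, by norm_num, by norm_num⟩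
  let qb : ContDiffBump (-(59 / 400) : ℝ) := ⟨1 / 800, 1 / 400, by norm_num, by norm_num⟩
  have hpr : pb.rOut = 1 / 400 := rfl
  have hqr : qb.rOut = 1 / 400 := rfl
  -- support facts
  have hpz : ∀ x, (pb : ℝ → ℝ) x ≠ 0 → |x - 59 / 400| < 1 / 400 := fun x hx ↦ by
    by_contra h
    exact hx (bump_eq_zero_of_le pb (by rw [hpr]; exact not_lt.1 h))
  have hqz : ∀ x, (qb : ℝ → ℝ) x ≠ 0 → |x + 59 / 400| < 1 / 400 := fun x hx ↦ by
    by_contra h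
    refine hx (bump_eq_zero_of_le qb ?_)
    rw [hqr, sub_neg_eq_add]; exact not_lt.1 h
  have hp0 : ∀ x, 0 ≤ (pb : ℝ → ℝ) x := fun x ↦ pb.nonneg
  have hq0 : ∀ x, 0 ≤ (qb : ℝ → ℝ) x := fun x ↦ qb.nonneg
  have hdisj : ∀ x, (pb : ℝ → ℝ) x = 0 ∨ (qb : ℝ → ℝ) x = 0 := by
    intro x
    by_contra h
    rw [not_or] at h
    have h1 := hpz x h.1
    have h2 := hqz x h.2
    rw [abs_lt] at h1 h2
    linarith [h1.1, h2.2]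
  set u : ℝ → ℝ := fun x ↦ (pb : ℝ → ℝ) x - (qb : ℝ → ℝ) x with hudef
  have huc : ContDiff ℝ (⊤ : ℕ∞) u := pb.contDiff.sub qb.contDiff
  have hum : Measurable u := huc.continuous.measurable
  -- `u` vanishes off `[-3/20, 3/20]`
  have huz : ∀ x, 3 / 20 < |x| → u x = 0 := by
    intro x hx
    have h1 : (pb : ℝ → ℝ) x = 0 := by
      by_contra h
      have := hpz x h
      rw [abs_lt] at this
      have : |x| ≤ 3 / 20 := abs_le.2 ⟨by linarith [this.1], by linarith [this.2]⟩
      linarith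
    have h2 : (qb : ℝ → ℝ) x = 0 := by
      by_contra h
      have := hqz x h
      rw [abs_lt] at this
      have : |x| ≤ 3 / 20 := abs_le.2 ⟨by linarith [this.1], by linarith [this.2]⟩
      linarith
    simp only [hudef, h1, h2, sub_zero]
  obtain ⟨hts, hcs⟩ := tsupport_subset_of_eq_zero huz
  have hW : IsWeilTest fun x ↦ ((u x : ℝ) : ℂ) := sw_isWeilTest_ofReal_comp huc hcs
  have htsC : tsupport (fun x ↦ ((u x : ℝ) : ℂ)) ⊆ Icc (-a) a := by
    rw [sw_tsupport_ofReal_comp]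
    exact hts.trans (Icc_subset_Icc (by linarith) ha)
  have hU : coreAdm a (fun x ↦ ((u x : ℝ) : ℂ)) := coreAdm_of_isWeilTest hW htsC
  -- `u⁺ = pb`, `u⁻ = qb`
  have hpos : ∀ x, max (u x) 0 = (pb : ℝ → ℝ) x := by
    intro x
    rcases hdisj x with h | h
    · simp only [hudef, h, zero_sub, max_eq_right (neg_nonpos.2 (hq0 x))]
    · simp only [hudef, h, sub_zero, max_eq_left (hp0 x)]
  have hneg : ∀ x, max (-u x) 0 = (qb : ℝ → ℝ) x := by
    intro x
    rcases hdisj x with h | h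
    · simp only [hudef, h, zero_sub, neg_neg, max_eq_left (hq0 x)]
    · simp only [hudef, h, sub_zero, max_eq_right (neg_nonpos.2 (hp0 x))]
  -- separation `29/100` and prime avoidance
  have hsep : ∀ x y, (pb : ℝ → ℝ) x ≠ 0 → (qb : ℝ → ℝ) y ≠ 0 → 29 / 100 ≤ |x - y| := by
    intro x y hx hy
    have h1 := hpz x hx
    have h2 := hqz y hy
    rw [abs_lt] at h1 h2
    rw [abs_of_pos (by linarith [h1.1, h2.2] : 0 < x - y)]
    linarith [h1.1, h2.2]
  have hprime : ∀ n ∈ weilPrimeIndex a, ∀ y, (qb : ℝ → ℝ) y ≠ 0 →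
      (pb : ℝ → ℝ) (y + Real.log n) = 0 ∧ (pb : ℝ → ℝ) (y - Real.log n) = 0 := by
    intro n _ y hy
    have h2 := hqz y hy
    rw [abs_lt] at h2
    have hz : ∀ z, z - 59 / 400 ≤ -(1 / 400) ∨ 1 / 400 ≤ z - 59 / 400 → (pb : ℝ → ℝ) z = 0 :=
      fun z hz ↦ by
        by_contra h
        have := hpz z h
        rw [abs_lt] at this
        rcases hz with hz | hz <;> linarith [this.1, this.2]
    by_cases hn : n < 2
    · have hl : Real.log (n : ℝ) = 0 := by interval_cases n <;> simp
      rw [hl, add_zero, sub_zero]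
      exact ⟨hz y (Or.inl (by linarith [h2.2])), hz y (Or.inl (by linarith [h2.2]))⟩
    · push Not at hn
      have hn' : (2 : ℝ) ≤ n := by exact_mod_cast hn
      have hl : Real.log 2 ≤ Real.log (n : ℝ) := Real.log_le_log (by norm_num) hn'
      have hl2 := Real.log_two_gt_d9
      exact ⟨hz _ (Or.inr (by linarith [h2.1])), hz _ (Or.inl (by linarith [h2.2]))⟩
  -- positive masses
  have hIp : 0 < ∫ x, (pb : ℝ → ℝ) x :=
    sw_integral_pos pb.continuous (pb.continuous.integrable_of_hasCompactSupport pb.hasCompactSupport)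
      hp0 (pb.pos_of_mem_ball (Metric.mem_ball_self pb.rOut_pos))
  have hIq : 0 < ∫ x, (qb : ℝ → ℝ) x :=
    sw_integral_pos qb.continuous (qb.continuous.integrable_of_hasCompactSupport qb.hasCompactSupport)
      hq0 (qb.pos_of_mem_ball (Metric.mem_ball_self qb.rOut_pos))
  exact ⟨u, hum, hU, fold_lt_of_separated w hum hU hpos hneg (by norm_num) hsep hprime
    weilArchDensity_lt_two_mul_cosh_of hIp hIq⟩

/-! ### The negation spelled out -/

/-- At every window `a ≥ 3/20` folding RAISES the full form of every real table somewhere on the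
finite-energy class: the form is not sign-improving there. [folklore] -/
theorem not_forall_fold_le_of_ge (w : ℕ → ℝ) (ha : 3 / 20 ≤ a) :
    ¬ ∀ u : ℝ → ℝ, Measurable u → coreAdm a (fun x ↦ ((u x : ℝ) : ℂ)) →
      tableClosedForm a w (fun x ↦ ((|u x| : ℝ) : ℂ)) ≤
        tableClosedForm a w (fun x ↦ ((u x : ℝ) : ℂ)) := by
  intro h
  obtain ⟨u, hum, hU, hlt⟩ := exists_fold_lt_of_ge w ha
  exact absurd (h u hum hU) (not_le.2 hlt)

end Summit.RiemannHypothesis.RiemannHypothesis.Theorems.PfPersistence
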